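import Mathlib.GroupTheory.Index
import HarnessLib

/-!
# Group-theoretic half of [SemiAnbd] Remark 2.4.1, second sentence (aloof / estranged edges pull back)

Mochizuki, *Semi-graphs of anabelioids*, Publ. RIMS **42** (2006) 221–322, §2, Remark 2.4.1, p. 26
[cite: MochizukiSemiAnbd2006, Rem. 2.4.1 p.26]: "if `𝒢' → 𝒢` is a finite étale covering, and `e'` is an
edge of `𝒢'` that maps to an … aloof (respectively, estranged) edge `e` of `𝒢`, then … `e'` is … aloof
(respectively, estranged)".  Along such a covering the branch groups of `𝒢'` sit inside those of `𝒢`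
as subgroups of finite index (`Π_{v'} ↪ Π_v`, `Π_{b'} ↪ Π_b`), so the conditions of Definition 2.4
(iv) — "`Π_b ∩ g Π_{b'} g⁻¹` has infinite index in `Π_b`" (aloof), resp. "… is trivial" (estranged) —
are INHERITED by the smaller groups: this file proves exactly these inheritance lemmas (pure group
theory, Mathlib only).  The semi-graph-of-anabelioids half (the double-coset dictionary for the
branches of `𝒢'` over a branch of `𝒢`, Def. 2.2 (i)) is `CoverticialCoveringDoubleCoset.lean`; the two
assemble into clauses 3–4 of the named fact `remark_2_4_1_covering` (`Coverticial.lean`).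
-/

namespace Literature.AnabelianGeometry.SemiGraphs

variable {G : Type*} [Group G]

/-- Infinite index is inherited downwards on the left and right: if `A ∩ X` has infinite index in `A`,
`A' ≤ A` has finite index and `X' ≤ X`, then `A' ∩ X'` has infinite index in `A'` (used with
`A = Π_b`, `X = g Π_{b'} g⁻¹` and the finite-index branch groups of a finite étale covering).
[cite: MochizukiSemiAnbd2006, Rem. 2.4.1 p.26] -/
theorem relIndex_inf_eq_zero_of_le {A A' X X' : Subgroup G} (hA : (A ⊓ X).relIndex A = 0)
    (hA' : A' ≤ A) (hfin : A'.relIndex A ≠ 0) (hX' : X' ≤ X) : (A' ⊓ X').relIndex A' = 0 := by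
  by_contra h
  -- `A' ∩ X'` has finite index in `A'`, hence in `A`
  have h1 : (A' ⊓ X').relIndex A ≠ 0 := Subgroup.relIndex_ne_zero_trans h hfin
  -- and `A' ∩ X' ≤ A ∩ X`, so `A ∩ X` has finite index in `A`
  have h2 : A' ⊓ X' ≤ A ⊓ X := inf_le_inf hA' hX'
  have h3 : (A ⊓ X).relIndex A ∣ (A' ⊓ X').relIndex A := Subgroup.relIndex_dvd_of_le_left A h2
  rw [hA] at h3
  exact h1 (Nat.eq_zero_of_zero_dvd h3)

/-- Triviality of the intersection is inherited: `A ∩ X = 1`, `A' ≤ A`, `X' ≤ X` ⇒ `A' ∩ X' = 1`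
(the "estranged" half). [cite: MochizukiSemiAnbd2006, Rem. 2.4.1 p.26] -/
theorem inf_eq_bot_of_le {A A' X X' : Subgroup G} (hA : A ⊓ X = ⊥) (hA' : A' ≤ A) (hX' : X' ≤ X) :
    A' ⊓ X' = ⊥ :=
  le_bot_iff.mp (hA ▸ inf_le_inf hA' hX')

/-- The aloofness condition at strength "infinite index AND trivial" (the estranged predicate of
`Commensurability.lean`) is inherited. [cite: MochizukiSemiAnbd2006, Rem. 2.4.1 p.26] -/
theorem estranged_inherit {A A' X X' : Subgroup G} (hA : (A ⊓ X).relIndex A = 0 ∧ A ⊓ X = ⊥)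
    (hA' : A' ≤ A) (hfin : A'.relIndex A ≠ 0) (hX' : X' ≤ X) :
    (A' ⊓ X').relIndex A' = 0 ∧ A' ⊓ X' = ⊥ :=
  ⟨relIndex_inf_eq_zero_of_le hA.1 hA' hfin hX', inf_eq_bot_of_le hA.2 hA' hX'⟩

open scoped Pointwise in
/-- Conjugation bookkeeping: for `x ∈ G` and subgroups `B' ≤ B`, `x B' x⁻¹ ≤ x B x⁻¹`; combined with
the lemmas above this handles the conjugates `g Π_{b'} g⁻¹` of Definition 2.4 (iv).
[cite: MochizukiSemiAnbd2006, Rem. 2.4.1 p.26] -/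
theorem conjAct_smul_mono (x : ConjAct G) {B B' : Subgroup G} (h : B' ≤ B) : x • B' ≤ x • B :=
  Subgroup.pointwise_smul_le_pointwise_smul_iff.mpr h

open scoped Pointwise in
/-- The typical instance: if `Π_b ∩ g Π_c g⁻¹` has infinite index in `Π_b` for EVERY `g`, then for
finite-index `A' ≤ Π_b`, any `C' ≤ Π_c` and any `g`, `A' ∩ g C' g⁻¹` has infinite index in `A'`.
[cite: MochizukiSemiAnbd2006, Rem. 2.4.1 p.26] -/
theorem relIndex_inf_conj_eq_zero_of_le {A A' C C' : Subgroup G}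
    (hA : ∀ g : ConjAct G, (A ⊓ g • C).relIndex A = 0) (hA' : A' ≤ A) (hfin : A'.relIndex A ≠ 0)
    (hC' : C' ≤ C) (g : ConjAct G) : (A' ⊓ g • C').relIndex A' = 0 :=
  relIndex_inf_eq_zero_of_le (hA g) hA' hfin (conjAct_smul_mono g hC')

end Literature.AnabelianGeometry.SemiGraphs
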